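import Summits.QuantumFields.YangMills.Theorems.BalabanUVNodesK0AllTorusOfStepTokensGuarded
import Summits.QuantumFields.YangMills.Theorems.BalabanUVNodesK0PrintCubeOfStepTokensRFloor

/-!
# K0⁷ — PART 2 IN GUARD CURRENCY: STUB 2′ FILLS THE GUARDED (9)-SUPPLIER SLOT, AND THE THREE-STUB COMPOSITION OF V20 OPTION G
# `record13SepCoPHBody_of_stubs1G_2P_3A'G : stub 1-G ∧ stub 2′ ∧ 3ᴬ′-G ⟹ K0⁷'s body on every family`

Cell `pub-ymgap`, seat `pub-ymgap-k0-s1-w3` generation 7 (K0⁷ `stmt-QuantumFields-20541`, V19 stub 1 `stub_prop8StepCoP13` helper lane;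
`--kind proof --supports stmt-QuantumFields-20541 --as helper`).  NEW leaf over the sibling `…K0AllTorusOfStepTokensGuarded` (PART 1-G), this seat's `…K0PrintCubeOfStepTokensRFloor`
(`max_floor_le_pow`) and dag-n07-e's module 51 (`Node00/TorusCoverGaugeTokensGuarded`, p627663: the guarded (9)-token from the GUARDED top step and [6] Prop. 6 on print's class, guard
`Adm ⊓ floorGuard ((11·4 + 4ρ₀L)·L)`).  Theorems only (0 `def`, 0 `sorry`); nothing in the tree is modified.

THE V20 OPTION-G TEXTS (lane owner dag-n07-e's `V20-STUB1-TEXT-PROPOSAL.md`, 2026-08-28; NOT registered here — the plan words and registers; `A(c, c₀) := fun ν _M _g K k _s =>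
c ≤ ν.M₁ ∧ k + c₀ ≤ F.m + K`, written out literally below):
* stub 1-G  `∃ (c c₀ : ℕ) (B₃ a₀ a₁ : ℝ), 2·(F.L)² ≤ B₃ ∧ 0 < a₀ ∧ 0 < a₁ ∧ Prop8RegSepTopStepG F 2 suppDom (A c c₀) B₃ a₀ a₁` (module 47; both letters ∃-bound OUTERMOST);
* stub 2′   UNCHANGED (V19; landed BY NAME, k0-s2-w1 p595104);
* 3ᴬ′-G     `∀ (j c c₀ : ℕ) (B₃ B₃' a₀ a₁ : ℝ), c ≤ F.L^j → c₀ ≤ j + 1 → 2·(F.L)² ≤ B₃ → 0 < B₃' → 0 < a₀ → 0 < a₁ → VariationalThm1RegSepCoP7MG F 2 (A c c₀) B₃ a₀ a₁ →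
            Gauge9RegSepTopStepG F 2 suppDom (F.L^j) (A c c₀) B₃ B₃' a₀ a₁ → ∃ γ₀ ε₀ ε₂₉ β', …` (the abs β-box of `θ₁₅ᶜᶜᴹ(j)` on some window; `c₀ ≤ j + 1` is the level analogue of `c ≤ L^j`).
§1 fills PART 1-G's generic G-supplier slot from stub 2′: at letters `(c, c₀)` and bare size `ρ₀` the guarded (9)-token holds at the cube letter `L^j`, `j := ρ₀ + 3 + c + c₀`, under the
guard `A(c′, c₀)`, `c′ := max c ((11·4 + 4ρ₀L)·L)` (`c ≤ c′ ≤ L^j`, `c₀ ≤ j + 1`; module 51's guard `A(c, c₀) ⊓ floor c(ρ₀)` refined by `.of_imp`).  §2 is the composition the V20-G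
skeleton's `Record13SepCoPHInhabited_of` can cite BY NAME; §3 displays that V19's and V20-R's stub-1 texts still feed it.

HONEST FRAMING: count-neutral kernel bookkeeping BY NAME; CONDITIONAL compositions whose antecedents are OPEN (stub 1-G = N07's [15] Prop. 8 ∕ Sect. F at objects, guarded «of the
construction»; stub 2′ = N05's [6] Prop. 6 on print's cubes; 3ᴬ′-G = NODE O, print-STATED [I] §1 p.264 with unpublished proof [II] p.355); nothing of Bałaban asserted; a skeleton re-text
is NOT progress by itself; `stub_prop8StepCoP13` ∕ K0⁷ ∕ K1⁹ NOT closed; N07 NOT discharged; counts unmoved (typed 28∕28 · discharged 5∕27); the route closes only the conditional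
finite-𝕋⁴ rung `BalabanLadder.UV` — the YM mass gap (Clay) is NOT proved by any of this; nothing continuum ∕ ℝ⁴ ∕ OS.  No `sorry`, `def`, `instance`, `notation`.
[15] = Bałaban, CMP 102 (1985) 277–309 [Balaban1985Variational]; [6] = CMP 99 (1985) 75 [Balaban1985RegularSpaces]; [III] = CMP 119 (1988) 243 [Balaban1988Convergent];
[I] = CMP 109 (1987) 249 [Balaban1987RG1]; [II] = CMP 122 (1989) 355 [Balaban1989LargeFieldII].
-/

noncomputable section

open scoped Matrix.Norms.L2Operator

namespace Summit.QuantumFields.YangMills.Theorems.K0PrintCubeOfStepTokensGuarded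

open Literature.MathematicalPhysics.QuantumFieldTheory.Balaban1983to89
open Literature.MathematicalPhysics.QuantumFieldTheory.Balaban1983to89.Node00
open Literature.MathematicalPhysics.QuantumFieldTheory.Balaban1983to89.T4Continuum
open Literature.MathematicalPhysics.QuantumFieldTheory.Balaban1983to89.FlowStep
open Literature.MathematicalPhysics.QuantumFieldTheory.Balaban1983to89.B8LeafModelZd (ZdIdx)
open Summit.QuantumFields.YangMills.Theorems.K0PrintCubeOfStepTokensRFloor (max_floor_le_pow)
open Summit.QuantumFields.YangMills.Theorems.K0AllTorusOfStepTokensRFloor (prop8StepCoPR_of_prop8StepCoP)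
open Summit.QuantumFields.YangMills.Theorems.K0AllTorusOfStepTokensGuarded (record13SepCoPHBody_of_stub1G_of_gauge9SupplierG_of_absBetaBoxAtG prop8StepCoPG_of_prop8StepCoPR)

/-! ## §1  Stub 2′ fills PART 1-G's guarded (9)-supplier slot -/

section Supplier

variable (F : T4Family)

/-- **STUB 2′ AT `F` FILLS PART 1-G's GUARDED (9)-SUPPLIER SLOT AT `F`**: from [6] Prop. 6 on print's cube class at big-block size `ρ₀ ≥ 1` (`zdCubP (MatA 2) L ρ₀`, constants `0 ≤ B₁`,
`0 < c₁`), for every letter pair `(c, c₀)` and guarded `(B₃, a₀, a₁)` carrying [15] Prop. 8's GUARDED top step under `A(c, c₀)`, the guarded (9)-token holds at the cube letter `L^j`,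
`j := ρ₀ + 3 + c + c₀`, under the guard `A(c′, c₀)`, `c′ := max c ((11·4 + 4·(ρ₀·L))·L)` (`c ≤ c′ ≤ L^j`, `c₀ ≤ j + 1`), with `B₉ = b9OfP·B₃` and the shrunk ceiling `a₁′ = min a₁ (a0OfP∕B₃)`
— dag-n07-e's module 51 `gauge9GP_of_prop8TopStepG_of_prop6P_of_one_le` BY NAME at `M := L^j` (guard `A(c, c₀) ⊓ floor c(ρ₀)` refined to `A(c′, c₀)` by `.of_imp`), Prop. 8's ceiling shrunk
by `.of_le`.  CONDITIONAL. [cite: Balaban1985Variational, Thm 1 (8)–(10) p.279, (144)–(152) pp.300–301, Prop. 8 p.304, p.304 lines 1–2; Balaban1985RegularSpaces, Prop. 6 p.99, p.98; Balaban1987RG1, (0.1) p.251] -/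
theorem gauge9SupplierG_of_prop6MemberP
    (h2P : ∃ (ρ₀ : ℕ) (B₁ c₁ : ℝ), 1 ≤ ρ₀ ∧ 0 ≤ B₁ ∧ 0 < c₁ ∧
      (letI : CStarAlgebra (MatA 2) := {}; B8.Prop6Printed 4 (F.L : ℝ) B₁ c₁ (fun i : ZdIdx 4 F.L => zdCubP (MatA 2) F.L ρ₀ i)))
    (c c₀ : ℕ) (B₃ a₀ a₁ : ℝ) (hB₃ : 2 * (F.L : ℝ) ^ 2 ≤ B₃) (_ha₀ : 0 < a₀) (ha₁ : 0 < a₁)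
    (h8 : Prop8RegSepTopStepG F 2 (fun ν K Ω => suppDomOfRecord F ν K Ω) (fun ν _M _g K k _s => c ≤ ν.M₁ ∧ k + c₀ ≤ F.m + K) B₃ a₀ a₁) :
    ∃ (j c' : ℕ) (B₉ a₁' : ℝ), c ≤ c' ∧ c' ≤ F.L ^ j ∧ c₀ ≤ j + 1 ∧ 0 < B₉ ∧ 0 < a₁' ∧ a₁' ≤ a₁ ∧
      Gauge9RegSepTopStepG F 2 (fun ν K Ω => suppDomOfRecord F ν K Ω) (F.L ^ j) (fun ν _M _g K k _s => c' ≤ ν.M₁ ∧ k + c₀ ≤ F.m + K) B₃ B₉ a₀ a₁' := by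
  obtain ⟨ρ₀, B₁, c₁, hρ₀, hB₁, hc₁, hP6⟩ := h2P
  have hL : (0 : ℝ) < (F.L : ℝ) := by exact_mod_cast lt_trans Nat.zero_lt_one F.hL.2
  have hBpos : (0 : ℝ) < B₃ := lt_of_lt_of_le (mul_pos two_pos (pow_pos hL 2)) hB₃
  set M : ℕ := F.L ^ (ρ₀ + 3 + c + c₀) with hM
  have ha0P : 0 < a0OfP F 2 M (ρ₀ * F.L) B₁ c₁ := a0OfP_pos (F := F) (N := 2) M (ρ₀ * F.L) hB₁ hc₁
  have ha₁' : 0 < min a₁ (a0OfP F 2 M (ρ₀ * F.L) B₁ c₁ / B₃) := lt_min ha₁ (div_pos ha0P hBpos)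
  have hle : B₃ * min a₁ (a0OfP F 2 M (ρ₀ * F.L) B₁ c₁ / B₃) ≤ a0OfP F 2 M (ρ₀ * F.L) B₁ c₁ :=
    calc B₃ * min a₁ (a0OfP F 2 M (ρ₀ * F.L) B₁ c₁ / B₃) ≤ B₃ * (a0OfP F 2 M (ρ₀ * F.L) B₁ c₁ / B₃) :=
          mul_le_mul_of_nonneg_left (min_le_right _ _) hBpos.le
      _ = a0OfP F 2 M (ρ₀ * F.L) B₁ c₁ := mul_div_cancel₀ _ hBpos.ne'
  have hL0 : 0 < F.L := by have := F.hL.2; omega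
  have hfloor : max c ((11 * 4 + 4 * (ρ₀ * F.L)) * F.L) ≤ F.L ^ (ρ₀ + 3 + c + c₀) :=
    (max_floor_le_pow F hρ₀ c).trans (Nat.pow_le_pow_right hL0 (by omega))
  exact ⟨ρ₀ + 3 + c + c₀, max c ((11 * 4 + 4 * (ρ₀ * F.L)) * F.L), b9OfP F M (ρ₀ * F.L) B₁ * B₃, min a₁ (a0OfP F 2 M (ρ₀ * F.L) B₁ c₁ / B₃),
    le_max_left _ _, hfloor, by omega, mul_pos (b9OfP_pos (F := F) M (ρ₀ * F.L) hB₁) hBpos, ha₁', min_le_left _ _,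
    (gauge9GP_of_prop8TopStepG_of_prop6P_of_one_le (h8.of_le le_rfl (min_le_left _ _)) hB₁ hc₁ hρ₀ hP6 M hBpos hle).of_imp
      fun _ _ _ _ _ _ h => ⟨⟨(le_max_left _ _).trans h.1, h.2⟩, (le_max_right _ _).trans h.1⟩⟩

end Supplier

/-! ## §2  ★★★ The V20 option-G composition: stub 1-G ∧ stub 2′ ∧ 3ᴬ′-G ⟹ K0⁷'s body on every family -/

section Composition

/-- **★★★ K0⁷'s BODY AT EVERY FAMILY FROM STUB 1-G, STUB 2′ AND 3ᴬ′-G** — `h1G` = the V20 option-G stub-1 text VERBATIM ([15] Prop. 8's top step at the record's support selector under the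
two-letter guard `A(c, c₀)` for SOME `(c, c₀)` and guarded `(B₃, a₀, a₁)`; `Prop8RegSepTopStepG`, module 47); `h2P` = STUB 2′ VERBATIM; `h3A'G` = 3ᴬ′-G (the sign-free β-box of A1's witness
`θ₁₅ᶜᶜᴹ(j)` on some window, for every cube letter `(j, c, c₀)` with `c ≤ L^j`, `c₀ ≤ j + 1` and every guarded tuple carrying the GUARDED (8) and (9)-token under `A(c, c₀)`).  Proof: §1 fills
PART 1-G's supplier slot, then `record13SepCoPHBody_of_stub1G_of_gauge9SupplierG_of_absBetaBoxAtG`.  The shape the V20-G skeleton's `Record13SepCoPHInhabited_of h1G h2P h3A'G` cites BY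
NAME.  CONDITIONAL; K0⁷ NOT closed here; nothing of Bałaban asserted; a re-text is not progress.
[cite: Balaban1985Variational, Thm 1 (8)–(9) p.279, (144)–(152) pp.300–301, Prop. 8 p.304, p.304 lines 1–2; Balaban1985RegularSpaces, (1.3)–(1.6) p.77, Prop. 6 p.99, p.98; Balaban1988Convergent, Thm 1 p.262, (2.6)–(2.8) pp.255–256, p.257; Balaban1987RG1, Thm 1 p.259, (0.1) p.251, §1 p.264] -/
theorem record13SepCoPHBody_of_stubs1G_2P_3A'G
    (h1G : ∀ F : T4Family, ∃ (c c₀ : ℕ) (B₃ a₀ a₁ : ℝ), 2 * (F.L : ℝ) ^ 2 ≤ B₃ ∧ 0 < a₀ ∧ 0 < a₁ ∧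
      Prop8RegSepTopStepG F 2 (fun ν K Ω => suppDomOfRecord F ν K Ω) (fun ν _M _g K k _s => c ≤ ν.M₁ ∧ k + c₀ ≤ F.m + K) B₃ a₀ a₁)
    (h2P : ∀ F : T4Family, ∃ (ρ₀ : ℕ) (B₁ c₁ : ℝ), 1 ≤ ρ₀ ∧ 0 ≤ B₁ ∧ 0 < c₁ ∧
      (letI : CStarAlgebra (MatA 2) := {}; B8.Prop6Printed 4 (F.L : ℝ) B₁ c₁ (fun i : ZdIdx 4 F.L => zdCubP (MatA 2) F.L ρ₀ i)))
    (h3A'G : ∀ (F : T4Family) (j c c₀ : ℕ) (B₃ B₃' a₀ a₁ : ℝ), c ≤ F.L ^ j → c₀ ≤ j + 1 → 2 * (F.L : ℝ) ^ 2 ≤ B₃ → 0 < B₃' → 0 < a₀ → 0 < a₁ →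
      VariationalThm1RegSepCoP7MG F 2 (fun ν _M _g K k _s => c ≤ ν.M₁ ∧ k + c₀ ≤ F.m + K) B₃ a₀ a₁ →
      Gauge9RegSepTopStepG F 2 (fun ν K Ω => suppDomOfRecord F ν K Ω) (F.L ^ j) (fun ν _M _g K k _s => c ≤ ν.M₁ ∧ k + c₀ ≤ F.m + K) B₃ B₃' a₀ a₁ →
      ∃ γ₀ ε₀ ε₂₉ β' : ℝ, 0 < γ₀ ∧ 0 < ε₀ ∧ 0 < ε₂₉ ∧
        BetaLowerH (-β') γ₀ (betaOfRecord₁₃ F 2 (theta13OfThm1CCM F 2 j ε₀ ε₂₉ B₃ B₃' a₀ a₁)) ∧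
        BetaUpperH β' γ₀ (betaOfRecord₁₃ F 2 (theta13OfThm1CCM F 2 j ε₀ ε₂₉ B₃ B₃' a₀ a₁))) :
    ∀ F : T4Family, ∃ θ : Stage13HParams F 2, θ.Provisos₁₃SepCoPH F 2 ∧ (θ.ZhUnity F 2 ∧ θ.SlotsNondegenerate₁₃ F 2) ∧ θ.Admissible F 2 :=
  record13SepCoPHBody_of_stub1G_of_gauge9SupplierG_of_absBetaBoxAtG h1G
    (fun F c c₀ B₃ a₀ a₁ hB₃ ha₀ ha₁ h8 => gauge9SupplierG_of_prop6MemberP F (h2P F) c c₀ B₃ a₀ a₁ hB₃ ha₀ ha₁ h8) h3A'G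

/-- **DOOR FOR THE BINDER-FREE 3ᴬ′-G TEXT** (plan g86 WORD V20 = G, first wording: V19's 3ᴬ′ binders `(j c c₀)` with both antecedents guarded, WITHOUT the level letter
`c₀ ≤ j + 1`): that text is STRONGER than §2's `h3A'G` (it also claims the box at `c₀ > j + 1`, where the guarded antecedents are idle at the witness's torus-compatible runs — this
seat's LOCATED-3ᴬ′G-LEVEL-BINDER), so it feeds §2 by forgetting the binder.  Whichever wording the plan registers, the body follows BY NAME.  CONDITIONAL.
[cite: Balaban1987RG1, §1 p.264 (bookkeeping); Balaban1985Variational, Prop. 8 p.304, p.304 lines 1–2] -/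
theorem record13SepCoPHBody_of_stubs1G_2P_3A'Gstrong
    (h1G : ∀ F : T4Family, ∃ (c c₀ : ℕ) (B₃ a₀ a₁ : ℝ), 2 * (F.L : ℝ) ^ 2 ≤ B₃ ∧ 0 < a₀ ∧ 0 < a₁ ∧
      Prop8RegSepTopStepG F 2 (fun ν K Ω => suppDomOfRecord F ν K Ω) (fun ν _M _g K k _s => c ≤ ν.M₁ ∧ k + c₀ ≤ F.m + K) B₃ a₀ a₁)
    (h2P : ∀ F : T4Family, ∃ (ρ₀ : ℕ) (B₁ c₁ : ℝ), 1 ≤ ρ₀ ∧ 0 ≤ B₁ ∧ 0 < c₁ ∧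
      (letI : CStarAlgebra (MatA 2) := {}; B8.Prop6Printed 4 (F.L : ℝ) B₁ c₁ (fun i : ZdIdx 4 F.L => zdCubP (MatA 2) F.L ρ₀ i)))
    (h3A'Gs : ∀ (F : T4Family) (j c c₀ : ℕ) (B₃ B₃' a₀ a₁ : ℝ), c ≤ F.L ^ j → 2 * (F.L : ℝ) ^ 2 ≤ B₃ → 0 < B₃' → 0 < a₀ → 0 < a₁ →
      VariationalThm1RegSepCoP7MG F 2 (fun ν _M _g K k _s => c ≤ ν.M₁ ∧ k + c₀ ≤ F.m + K) B₃ a₀ a₁ →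
      Gauge9RegSepTopStepG F 2 (fun ν K Ω => suppDomOfRecord F ν K Ω) (F.L ^ j) (fun ν _M _g K k _s => c ≤ ν.M₁ ∧ k + c₀ ≤ F.m + K) B₃ B₃' a₀ a₁ →
      ∃ γ₀ ε₀ ε₂₉ β' : ℝ, 0 < γ₀ ∧ 0 < ε₀ ∧ 0 < ε₂₉ ∧
        BetaLowerH (-β') γ₀ (betaOfRecord₁₃ F 2 (theta13OfThm1CCM F 2 j ε₀ ε₂₉ B₃ B₃' a₀ a₁)) ∧
        BetaUpperH β' γ₀ (betaOfRecord₁₃ F 2 (theta13OfThm1CCM F 2 j ε₀ ε₂₉ B₃ B₃' a₀ a₁))) :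
    ∀ F : T4Family, ∃ θ : Stage13HParams F 2, θ.Provisos₁₃SepCoPH F 2 ∧ (θ.ZhUnity F 2 ∧ θ.SlotsNondegenerate₁₃ F 2) ∧ θ.Admissible F 2 :=
  record13SepCoPHBody_of_stubs1G_2P_3A'G h1G h2P fun F j c c₀ B₃ B₃' a₀ a₁ hc _ => h3A'Gs F j c c₀ B₃ B₃' a₀ a₁ hc

end Composition

/-! ## §3  Sanity: V19's and V20-R's stub-1 texts still feed the G composition -/

section Direction

/-- **V20-R's STUB 1 ∧ STUB 2′ ∧ 3ᴬ′-G ⟹ K0⁷'s BODY** (R ⟹ G on stub 1, sibling `prop8StepCoPG_of_prop8StepCoPR`).  CONDITIONAL; displayed, not a registration.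
[cite: Balaban1985Variational, Prop. 8 p.304, p.304 lines 1–2 (bookkeeping); Balaban1985RegularSpaces, Prop. 6 p.99; Balaban1987RG1, §1 p.264] -/
theorem record13SepCoPHBody_of_stubs1R_2P_3A'G
    (h1R : ∀ F : T4Family, ∃ (c : ℕ) (B₃ a₀ a₁ : ℝ), 2 * (F.L : ℝ) ^ 2 ≤ B₃ ∧ 0 < a₀ ∧ 0 < a₁ ∧
      Prop8RegSepTopStepR F 2 (fun ν K Ω => suppDomOfRecord F ν K Ω) c B₃ a₀ a₁)
    (h2P : ∀ F : T4Family, ∃ (ρ₀ : ℕ) (B₁ c₁ : ℝ), 1 ≤ ρ₀ ∧ 0 ≤ B₁ ∧ 0 < c₁ ∧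
      (letI : CStarAlgebra (MatA 2) := {}; B8.Prop6Printed 4 (F.L : ℝ) B₁ c₁ (fun i : ZdIdx 4 F.L => zdCubP (MatA 2) F.L ρ₀ i)))
    (h3A'G : ∀ (F : T4Family) (j c c₀ : ℕ) (B₃ B₃' a₀ a₁ : ℝ), c ≤ F.L ^ j → c₀ ≤ j + 1 → 2 * (F.L : ℝ) ^ 2 ≤ B₃ → 0 < B₃' → 0 < a₀ → 0 < a₁ →
      VariationalThm1RegSepCoP7MG F 2 (fun ν _M _g K k _s => c ≤ ν.M₁ ∧ k + c₀ ≤ F.m + K) B₃ a₀ a₁ →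
      Gauge9RegSepTopStepG F 2 (fun ν K Ω => suppDomOfRecord F ν K Ω) (F.L ^ j) (fun ν _M _g K k _s => c ≤ ν.M₁ ∧ k + c₀ ≤ F.m + K) B₃ B₃' a₀ a₁ →
      ∃ γ₀ ε₀ ε₂₉ β' : ℝ, 0 < γ₀ ∧ 0 < ε₀ ∧ 0 < ε₂₉ ∧
        BetaLowerH (-β') γ₀ (betaOfRecord₁₃ F 2 (theta13OfThm1CCM F 2 j ε₀ ε₂₉ B₃ B₃' a₀ a₁)) ∧
        BetaUpperH β' γ₀ (betaOfRecord₁₃ F 2 (theta13OfThm1CCM F 2 j ε₀ ε₂₉ B₃ B₃' a₀ a₁))) :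
    ∀ F : T4Family, ∃ θ : Stage13HParams F 2, θ.Provisos₁₃SepCoPH F 2 ∧ (θ.ZhUnity F 2 ∧ θ.SlotsNondegenerate₁₃ F 2) ∧ θ.Admissible F 2 :=
  record13SepCoPHBody_of_stubs1G_2P_3A'G (fun F => prop8StepCoPG_of_prop8StepCoPR F (h1R F)) h2P h3A'G

/-- **V19's STUB 1 ∧ STUB 2′ ∧ 3ᴬ′-G ⟹ K0⁷'s BODY** (V19 ⟹ R ⟹ G on stub 1) — so a by-name proof of V19's stub 1 still lands after either re-text; the only stub whose text got STRONGER
is 3ᴬ′ (G ⟹ R ⟹ V19).  CONDITIONAL; displayed, not a registration. [cite: Balaban1985Variational, Prop. 8 p.304 (bookkeeping); Balaban1985RegularSpaces, Prop. 6 p.99; Balaban1987RG1, §1 p.264] -/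
theorem record13SepCoPHBody_of_stubs1_2P_3A'G
    (h1 : ∀ F : T4Family, ∃ B₃ a₀ a₁ : ℝ, 2 * (F.L : ℝ) ^ 2 ≤ B₃ ∧ 0 < a₀ ∧ 0 < a₁ ∧
      Prop8RegSepTopStep F 2 (fun ν K Ω => suppDomOfRecord F ν K Ω) B₃ a₀ a₁)
    (h2P : ∀ F : T4Family, ∃ (ρ₀ : ℕ) (B₁ c₁ : ℝ), 1 ≤ ρ₀ ∧ 0 ≤ B₁ ∧ 0 < c₁ ∧
      (letI : CStarAlgebra (MatA 2) := {}; B8.Prop6Printed 4 (F.L : ℝ) B₁ c₁ (fun i : ZdIdx 4 F.L => zdCubP (MatA 2) F.L ρ₀ i)))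
    (h3A'G : ∀ (F : T4Family) (j c c₀ : ℕ) (B₃ B₃' a₀ a₁ : ℝ), c ≤ F.L ^ j → c₀ ≤ j + 1 → 2 * (F.L : ℝ) ^ 2 ≤ B₃ → 0 < B₃' → 0 < a₀ → 0 < a₁ →
      VariationalThm1RegSepCoP7MG F 2 (fun ν _M _g K k _s => c ≤ ν.M₁ ∧ k + c₀ ≤ F.m + K) B₃ a₀ a₁ →
      Gauge9RegSepTopStepG F 2 (fun ν K Ω => suppDomOfRecord F ν K Ω) (F.L ^ j) (fun ν _M _g K k _s => c ≤ ν.M₁ ∧ k + c₀ ≤ F.m + K) B₃ B₃' a₀ a₁ →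
      ∃ γ₀ ε₀ ε₂₉ β' : ℝ, 0 < γ₀ ∧ 0 < ε₀ ∧ 0 < ε₂₉ ∧
        BetaLowerH (-β') γ₀ (betaOfRecord₁₃ F 2 (theta13OfThm1CCM F 2 j ε₀ ε₂₉ B₃ B₃' a₀ a₁)) ∧
        BetaUpperH β' γ₀ (betaOfRecord₁₃ F 2 (theta13OfThm1CCM F 2 j ε₀ ε₂₉ B₃ B₃' a₀ a₁))) :
    ∀ F : T4Family, ∃ θ : Stage13HParams F 2, θ.Provisos₁₃SepCoPH F 2 ∧ (θ.ZhUnity F 2 ∧ θ.SlotsNondegenerate₁₃ F 2) ∧ θ.Admissible F 2 :=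
  record13SepCoPHBody_of_stubs1R_2P_3A'G (fun F => prop8StepCoPR_of_prop8StepCoP F (h1 F)) h2P h3A'G

end Direction

end Summit.QuantumFields.YangMills.Theorems.K0PrintCubeOfStepTokensGuarded

end
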